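import Summits.Ventures.PercRepro.ProfileGapMonoThresholdNullityThree

/-!
# PercRepro — THE TOP THRESHOLD AT NULLITY `3`, STEP 2: the fibre bound of the unit map (p5, gen 31;
`proofs/P5-GM1.md` §43(f)(2))

At nullity `3` a unit `(S, p)` — an independent boundary target `S` of the top threshold with a non-loop `p ∈ S` in
the closure of `E ∖ S` — is claimed by the deficient sets `B` (rank `3`, spanning complement, `#cl B = 4`) with
`p ∈ cl B` and `B ∩ S = ∅`.  With `W = E ∖ S` (`ρ(E) − 1` points), `Y = S ∖ p` and
`Λ = {w ∈ W : ρ(E ∖ (Y ∪ w)) + 2 ≤ ρ(E)}` (the points of `W` in the dual closure of `Y`): every claimant contains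
`W ∖ Λ` (`mem_dual_closure_of_claimant`, from the dual rank `2` of its complement `Y ∪ (W ∖ B)`), `W ∖ Λ` is not
empty (`exists_notMem_dual_closure`: otherwise every point of `W` is a coloop of `W ∪ p` and
`ρ(W ∪ p) = #W + ρ(p) = ρ(E)`, against `ρ(W ∪ p) = ρ(E ∖ Y) = ρ(E) − 1`), so a claimant is `(W ∖ Λ) ∪ A` with
`A` an `a`-subset of `Λ`, `a = 3 − #(W ∖ Λ) ≤ 2`, `#Λ = ρ(E) − 4 + a`, and **`card_claimants_le`**: at most
`C(ρ(E) − 2, 2)` claimants per unit.  Nothing open is asserted.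
-/

open scoped Matroid

namespace PercRepro.Cogirth

open Finset ThmH Skew Shadow Profile

variable {α : Type} [DecidableEq α] {N : Matroid α} [N.Finite]

/-- `C(r − 4 + a, a) ≤ C(r − 2, 2)` for `a ≤ 2` and `4 ≤ r`. -/
theorem choose_sub_four_add_le (r a : ℕ) (ha : a ≤ 2) (hr : 4 ≤ r) : (r - 4 + a).choose a ≤ (r - 2).choose 2 := by
  obtain ⟨s, rfl⟩ : ∃ s, r = s + 4 := ⟨r - 4, by omega⟩
  have h2 : (s + 4 - 2).choose 2 = (s + 2) * (s + 1) / 2 := by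
    rw [show s + 4 - 2 = s + 2 by omega, Nat.choose_two_right]
    rfl
  interval_cases a
  · simp only [add_zero, Nat.choose_zero_right, h2]
    have : 2 ≤ (s + 2) * (s + 1) := by nlinarith
    omega
  · simp only [Nat.choose_one_right, h2]
    rw [show s + 4 - 4 + 1 = s + 1 by omega]
    have : 2 * (s + 1) ≤ (s + 2) * (s + 1) := by nlinarith
    omega
  · rw [show s + 4 - 4 + 2 = s + 4 - 2 by omega]

section Fibre

variable (hn : (gr N).card = rk N (gr N) + 3)

include hn in
/-- At nullity `3` a target of the top threshold (rank `4`, co-rank `≥ ρ(E) − 1`) has exactly four points. -/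
theorem card_eq_four_of_mem_levelSetCoQ_top {S : Finset α} (hS : S ∈ levelSetCoQ N (rk N (gr N) - 1) 4)
    (hR : 4 ≤ rk N (gr N)) : S.card = 4 := by
  obtain ⟨⟨hSg, hSr⟩, hSt⟩ := mem_levelSetCoQ.1 hS
  have hrk : rk N S = 4 := rk_eq_of_eRk_eq_cq hSr
  have h1 := card_sdiff_add_card_eq_card hSg
  have h2 := rk_le_card' (M := N) (gr N \ S)
  have h3 := rk_le_card' (M := N) S
  omega

include hn in
/-- **A claimant contains every point of `W = E ∖ S` outside the dual closure of `Y = S ∖ p`**: a point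
`w ∈ W ∖ B` of a deficient `B` (rank `3`, spanning complement, `#cl B = 4`, `p ∈ cl B`, `B ∩ S = ∅`) has
`ρ(E ∖ (Y ∪ w)) + 2 ≤ ρ(E)`. -/
theorem mem_dual_closure_of_claimant {S : Finset α} (hSg : S ⊆ gr N) (hS4 : S.card = 4) {p : α} (hp : p ∈ S)
    {B : Finset α} (hB : B ∈ Rq N 3) (hBsp : rk N (gr N \ B) = rk N (gr N)) (hcl : (clF N B).card = 4)
    (hpcl : p ∈ clF N B) (hBS : B ∩ S = ∅) {w : α} (hw : w ∈ gr N \ S) (hwB : w ∉ B) :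
    rk N (gr N \ insert w (S.erase p)) + 2 ≤ rk N (gr N) := by
  have hBg : B ⊆ gr N := (mem_Rq.1 hB).1
  have hdisj : ∀ x, x ∈ B → x ∈ S → False := fun x hxB hxS => by
    have : x ∈ B ∩ S := mem_inter.2 ⟨hxB, hxS⟩
    rw [hBS] at this
    exact notMem_empty x this
  obtain ⟨hB3, _⟩ := card_eq_three_of_nullity_three hn hB hBsp
  obtain ⟨p', hp'B, hcl'⟩ := exists_eq_insert_of_card_clF_eq_four hBg hB3 hcl
  have hpp' : p = p' := by
    rw [hcl'] at hpcl
    rcases mem_insert.1 hpcl with h | h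
    · exact h
    · exact absurd (hdisj p h hp) id
  subst hpp'
  have hF : (clF N B).card + rk N (gr N) = (gr N).card + (4 - 3) := by omega
  have hX : insert w (S.erase p) ⊆ gr N \ clF N B := by
    intro x hx
    rcases mem_insert.1 hx with rfl | hx
    · refine mem_sdiff.2 ⟨(mem_sdiff.1 hw).1, ?_⟩
      rw [hcl']
      simp only [mem_insert, not_or]
      exact ⟨fun h => (mem_sdiff.1 hw).2 (h ▸ hp), hwB⟩
    · obtain ⟨hxp, hxS⟩ := mem_erase.1 hx
      refine mem_sdiff.2 ⟨hSg hxS, ?_⟩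
      rw [hcl']
      simp only [mem_insert, not_or]
      exact ⟨hxp, fun hxB => hdisj x hxB hxS⟩
  have hwS : w ∉ S.erase p := fun h => (mem_sdiff.1 hw).2 (mem_of_mem_erase h)
  have hcard : (insert w (S.erase p)).card = 4 := by
    rw [card_insert_of_notMem hwS, card_erase_of_mem hp, hS4]
  have h := rk_sdiff_add_card_le_of_subset_compl (q := 4) hB hF (by norm_num) hX
  omega

include hn in
/-- **`W ∖ Λ` is not empty**: for a boundary target `S` with a non-loop `p ∈ S` in the closure of `E ∖ S`, some
`w ∈ W = E ∖ S` has `ρ(E ∖ ((S ∖ p) ∪ w)) + 2 > ρ(E)` — otherwise every point of `W` is a coloop of `W ∪ p`, whose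
rank would be `#W + ρ(p) = ρ(E)` instead of `ρ(E ∖ (S ∖ p)) = ρ(E) − 1`. -/
theorem exists_notMem_dual_closure {S : Finset α} (hSg : S ⊆ gr N) (hS4 : S.card = 4)
    (hSb : rk N (gr N \ S) + 1 = rk N (gr N)) {p : α} (hp : p ∈ S) (hp1 : rk N {p} = 1)
    (hpcl : p ∈ clF N (gr N \ S)) :
    ∃ w ∈ gr N \ S, ¬ (rk N (gr N \ insert w (S.erase p)) + 2 ≤ rk N (gr N)) := by
  by_contra hall
  simp only [not_exists, not_and, not_not] at hall
  have hpg : p ∈ gr N := hSg hp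
  have hW : gr N \ S ⊆ gr N := sdiff_subset
  have hWcard : (gr N \ S).card + 4 = (gr N).card := by
    have := card_sdiff_add_card_eq_card hSg
    omega
  have hY : gr N \ S.erase p = insert p (gr N \ S) := by
    ext x
    simp only [mem_sdiff, mem_erase, mem_insert, not_and]
    constructor
    · rintro ⟨hx, hxe⟩
      by_cases hxp : x = p
      · exact Or.inl hxp
      · exact Or.inr ⟨hx, fun hxS => absurd hxS (hxe hxp)⟩
    · rintro (rfl | ⟨hx, hxS⟩)
      · exact ⟨hpg, fun h => absurd rfl h⟩
      · exact ⟨hx, fun _ => hxS⟩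
  have hrkY : rk N (insert p (gr N \ S)) = rk N (gr N) - 1 := by
    rw [rk_insert_eq hpg hW, if_pos hpcl]
    omega
  have hform := rk_union_eq_card_add_of_forall (N := N) {p} (singleton_subset_iff.2 hpg) (gr N \ S) hW
    (fun w hw => ?_)
  · rw [union_comm, ← insert_eq, hrkY, hp1] at hform
    omega
  · refine ⟨(insert p (gr N \ S)).erase w, (erase_subset _ _).trans (insert_subset hpg hW), ?_, ?_⟩
    · intro x hx
      rcases mem_union.1 hx with hx | hx
      · obtain ⟨hxw, hxW⟩ := mem_erase.1 hx
        exact mem_erase.2 ⟨hxw, mem_insert_of_mem hxW⟩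
      · rw [mem_singleton.1 hx]
        exact mem_erase.2 ⟨fun h => (mem_sdiff.1 hw).2 (h ▸ hp), mem_insert_self p _⟩
    · have hwp : w ≠ p := fun h => (mem_sdiff.1 hw).2 (h ▸ hp)
      have heq : (insert p (gr N \ S)).erase w = gr N \ insert w (S.erase p) := by
        ext x
        constructor
        · intro hx
          obtain ⟨hxw, hx⟩ := mem_erase.1 hx
          rcases mem_insert.1 hx with rfl | hx
          · refine mem_sdiff.2 ⟨hpg, ?_⟩
            simp only [mem_insert, mem_erase, ne_eq, not_true_eq_false, false_and, or_false]
            exact hxw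
          · obtain ⟨hxg, hxS⟩ := mem_sdiff.1 hx
            refine mem_sdiff.2 ⟨hxg, ?_⟩
            simp only [mem_insert, mem_erase, not_or, not_and]
            exact ⟨hxw, fun _ => hxS⟩
        · intro hx
          obtain ⟨hxg, hxn⟩ := mem_sdiff.1 hx
          simp only [mem_insert, mem_erase, not_or, not_and] at hxn
          obtain ⟨hxw, hxe⟩ := hxn
          refine mem_erase.2 ⟨hxw, ?_⟩
          by_cases hxp : x = p
          · exact mem_insert.2 (Or.inl hxp)
          · exact mem_insert.2 (Or.inr (mem_sdiff.2 ⟨hxg, fun hxS => hxe hxp hxS⟩))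
      rw [heq, mem_clF_iff_rk_insert (hW hw) sdiff_subset]
      have h1 := hall w hw
      have h2 : insert w (gr N \ insert w (S.erase p)) = insert p (gr N \ S) := by
        rw [← heq, insert_erase (mem_insert_of_mem hw)]
      rw [h2, hrkY]
      omega

include hn in
/-- **THE FIBRE BOUND**: at nullity `3`, `ρ(E) ≥ 4`, a unit `(S, p)` — `S` a boundary target of the top threshold
at co-rank `4`, `p ∈ S` a non-loop in the closure of `E ∖ S` — has at most `C(ρ(E) − 2, 2)` claimants: deficient
sets `B ∈ Rq N 3` with spanning complement, `#cl B = 4`, `p ∈ cl B` and `B ∩ S = ∅`. -/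
theorem card_claimants_le (hR : 4 ≤ rk N (gr N)) {S : Finset α} (hS : S ∈ levelSetCoQ N (rk N (gr N) - 1) 4)
    (hSb : rk N (gr N \ S) + 1 = rk N (gr N)) {p : α} (hp : p ∈ S) (hp1 : rk N {p} = 1)
    (hpcl : p ∈ clF N (gr N \ S)) :
    ((Rq N 3).filter (fun B => rk N (gr N \ B) = rk N (gr N) ∧ (clF N B).card = 4 ∧ p ∈ clF N B ∧
      B ∩ S = ∅)).card ≤ (rk N (gr N) - 2).choose 2 := by
  have hSg : S ⊆ gr N := (mem_levelSetCoQ.1 hS).1.1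
  have hS4 : S.card = 4 := card_eq_four_of_mem_levelSetCoQ_top hn hS hR
  have hWcard0 : (gr N \ S).card + 4 = (gr N).card := by
    have := card_sdiff_add_card_eq_card hSg
    omega
  set W := gr N \ S with hWdef
  set Λ := W.filter (fun w => rk N (gr N \ insert w (S.erase p)) + 2 ≤ rk N (gr N)) with hΛdef
  set K := W \ Λ with hKdef
  set 𝔅 := (Rq N 3).filter (fun B => rk N (gr N \ B) = rk N (gr N) ∧ (clF N B).card = 4 ∧ p ∈ clF N B ∧
    B ∩ S = ∅) with h𝔅def
  have hWcard : W.card + 4 = (gr N).card := hWcard0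
  -- K is not empty
  have hKne : 1 ≤ K.card := by
    obtain ⟨w, hw, hwn⟩ := exists_notMem_dual_closure hn hSg hS4 hSb hp hp1 hpcl
    exact card_pos.2 ⟨w, mem_sdiff.2 ⟨hw, fun hwΛ => hwn (mem_filter.1 hwΛ).2⟩⟩
  -- every claimant contains K and lies in W
  have hKsub : ∀ B ∈ 𝔅, K ⊆ B ∧ B ⊆ W := by
    intro B hB
    obtain ⟨hBq, hBsp, hcl, hpclB, hBS⟩ := mem_filter.1 hB
    refine ⟨fun w hw => ?_, fun x hx => ?_⟩
    · obtain ⟨hwW, hwΛ⟩ := mem_sdiff.1 hw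
      by_contra hwB
      exact hwΛ (mem_filter.2 ⟨hwW, mem_dual_closure_of_claimant hn hSg hS4 hp hBq hBsp hcl hpclB hBS hwW hwB⟩)
    · refine mem_sdiff.2 ⟨(mem_Rq.1 hBq).1 hx, fun hxS => ?_⟩
      have : x ∈ B ∩ S := mem_inter.2 ⟨hx, hxS⟩
      rw [hBS] at this
      exact notMem_empty x this
  by_cases hemp : 𝔅 = ∅
  · rw [hemp, card_empty]
    exact Nat.zero_le _
  obtain ⟨B₀, hB₀⟩ := nonempty_iff_ne_empty.2 hemp
  have hB₀3 : B₀.card = 3 := by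
    obtain ⟨hBq, hBsp, _, _, _⟩ := mem_filter.1 hB₀
    exact (card_eq_three_of_nullity_three hn hBq hBsp).1
  have hK3 : K.card ≤ 3 := hB₀3 ▸ card_le_card (hKsub B₀ hB₀).1
  -- the injection B ↦ B ∩ Λ into the (3 − #K)-subsets of Λ
  have hinj : ∀ B ∈ 𝔅, B = K ∪ (B ∩ Λ) := by
    intro B hB
    obtain ⟨hKB, hBW⟩ := hKsub B hB
    ext x
    simp only [mem_union, mem_inter]
    constructor
    · intro hx
      by_cases hxΛ : x ∈ Λ
      · exact Or.inr ⟨hx, hxΛ⟩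
      · exact Or.inl (mem_sdiff.2 ⟨hBW hx, hxΛ⟩)
    · rintro (hx | ⟨hx, _⟩)
      · exact hKB hx
      · exact hx
  have hcardΛ : ∀ B ∈ 𝔅, (B ∩ Λ).card = 3 - K.card := by
    intro B hB
    obtain ⟨hKB, hBW⟩ := hKsub B hB
    have hB3 : B.card = 3 := by
      obtain ⟨hBq, hBsp, _, _, _⟩ := mem_filter.1 hB
      exact (card_eq_three_of_nullity_three hn hBq hBsp).1
    have hdisj : Disjoint K (B ∩ Λ) := by
      rw [disjoint_left]
      intro x hxK hxΛ
      exact (mem_sdiff.1 hxK).2 (mem_inter.1 hxΛ).2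
    have := card_union_of_disjoint hdisj
    rw [← hinj B hB, hB3] at this
    omega
  have himage : 𝔅.card ≤ (Λ.powersetCard (3 - K.card)).card := by
    refine card_le_card_of_injOn (fun B => B ∩ Λ) (fun B hB => ?_) (fun B₁ hB₁ B₂ hB₂ heq => ?_)
    · exact mem_powersetCard.2 ⟨inter_subset_right, hcardΛ B hB⟩
    · simp only at heq
      rw [hinj B₁ hB₁, hinj B₂ hB₂, heq]
  rw [card_powersetCard] at himage
  have hΛcard : K.card + Λ.card = W.card := card_sdiff_add_card_eq_card (filter_subset _ _)
  have hΛ : Λ.card = rk N (gr N) - 4 + (3 - K.card) := by omega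
  rw [hΛ] at himage
  exact himage.trans (choose_sub_four_add_le _ _ (by omega) hR)

end Fibre

end PercRepro.Cogirth
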